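import Literature.NumberTheory.GaloisRepresentations.IdeleClassBarSModAlphaOne
import Literature.NumberTheory.GaloisRepresentations.IdeleClassBarSCoprimeAnnihilation
import Literature.NumberTheory.GaloisRepresentations.IdeleClassBarSLatticeCoprime
import Literature.Algebra.Homology.DiscreteRepFreePresentationPrimary
import Literature.Algebra.Homology.DiscreteRepTateDualityCoprime
import Mathlib.Algebra.Category.Grp.Injective
import HarnessLib

/-!
# The hypotheses of Tate's duality theorem AT EVERY PRIME `p` with `S ⊇ S_p` HOLD for the `S`-idèle class formation
# `(G_S, C̄_S, inv_S)`; hence Tate duality `αʳ(G_S, M)` (`r = 2, 1`) and `Ext³ = 0` for every finite `M ∈ C_{G_S}` whose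
# order is supported on `S` (Milne ADT I Thm. 1.8, Thm. 4.10 (proof); Harari Thm. 16.21, Remark 16.24, Thm. 17.18)

Topic `NumberTheory/GaloisRepresentations`; namespace `Literature.NumberTheory.GaloisRepresentations.IdeleClassBar`.  Assembly
file (theorems only; no definition, no named fact, no instance, no notation, no `sorry`) of the D2 bricks of the background
lane «PT-Ш-S-TC» of crux `GoodLatticeBDPValue` (stmt-BirchSwinnertonDyer-19032), cell `bsd-eis`:

* bsd-line-x1-p1-w7 g11's constructor `DiscreteRep.tateDualityHypothesesAt_of_coprime` (D0) fed with
  bsd-line-x1-p1-w5 g10's `tateDualityHypothesesAt_classBarSD_fields` (D2-CF: `invAt_injective`, `exists_invAt_eq`,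
  `ext_one_eq_zero`, `ext_two_divisible`), bsd-line-x1-p1-w4 g19's `ext_triv_coprime_classBarSD` and `hN_classBarSD` (D2-TN:
  Tate–Nakayama on the layers, annihilators prime to `p`), this seat's `adjointBijective_one_zmod_pow_classBarSD` (D2-(b):
  Milne's (b)) and Mathlib's `Module.Baer.of_divisible` for `ℚ/ℤ`:
  **`tateDualityHypothesesAt_classBarSD (hSp) : TateDualityHypothesesAt p (classBarSD K S) (invS S)`** — ALL TEN FIELDS, for
  every number field `K`, every finite set `S` of finite places and every prime `p` with `S ⊇ S_p`
  (`hSp : ∀ v, ↑p ∈ v.asIdeal → v ∈ ↑S`);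
* bsd-line-x1-p1-w7's engine at `p` (`tateDuality_finite_primary`) and the LEAD's primary decomposition
  (`tateDuality_finite_of_primary`): **`tateDuality_classBarSD_of_pow_nsmul`**, **`tateDuality_classBarSD`** — for every finite
  `M ∈ C_{G_S}` with every prime `ℓ ∣ #M` satisfying `S ⊇ S_ℓ`, `α²(G_S, M)` and `α¹(G_S, M)` are bijective and
  `Ext³_{C_{G_S}}(M, C̄_S) = 0`; **`adjointMap_one_injective_classBarSD`** — the `r = 1` input of Milne I 4.10 (b);
* §3 the same under the admissibility binder of the Poitou–Tate fact, `∀ v, (#M : 𝓞 K) ∈ v.asIdeal → v ∈ S`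
  (a private support-bookkeeping lemma): `tateDuality_classBarSD_of_natCard_mem`, **`adjointMap_one_bijective_classBarSD`**
  (the hypothesis `hα` of bsd-line-x1-p1-w2's D5c kit, as `Function.Bijective (adjointMap (invS S) M _)`),
  `adjointMap_two_bijective_classBarSD`, `ext_three_eq_zero_classBarSD`.

HONEST FRAMING: this is Tate's duality theorem for the `P`-class formation `(G_S, C̄_S)` (`P` = the primes with `S ⊇ S_p`;
Harari Thm. 17.18 with Remark 16.24; Milne ADT I Thm. 1.8 / 4.10 (a) for `G_S`), assembled in the tree's `Ext`-language from the
class field theory typed by the cell.  It is NOT yet Poitou–Tate duality for a finite Galois module (the idèle readout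
`Ext¹(M^D, Ī_S) = P¹_S` and the Ш-pairing are the D4/D5 bricks), and no case of BSD is proved; 0 cells / labels / tiers move.
Seat bsd-line-x1-p1-w8 g13.

## References
* J. S. Milne, *Arithmetic Duality Theorems* (2nd ed. 2006), I §1 Theorem 1.8, Lemma 1.9; §4 Theorem 4.10. [MilneADT2006]
* D. Harari, *Galois Cohomology and Class Field Theory*, Universitext (2020), §16.3 Theorem 16.21, §16.4 Remark 16.24, §17.1
  Theorem 17.2, §17.5 Theorem 17.18. [Harari2020]
* J. Tate, *Duality theorems in Galois cohomology over number fields*, Proc. ICM Stockholm 1962 (1963), 288–295.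
  [Tate1963DualityICM]
-/

noncomputable section

open NumberField IsDedekindDomain CategoryTheory CategoryTheory.Limits CategoryTheory.Abelian groupCohomology
open Field (absoluteGaloisGroup)
open Literature.NumberTheory.Automorphic Literature.NumberTheory.Automorphic.IdeleClassGroup
open Literature.NumberTheory.NumberFields
open Literature.Algebra.Homology Literature.Algebra.Homology.DiscreteRep Literature.Algebra.Homology.ExtDuality
open Literature.NumberTheory.GaloisRepresentations.LocalWeilDatum (galFixing)
open scoped Classical

namespace Literature.NumberTheory.GaloisRepresentations

namespace IdeleClassBar

variable {K : Type} [Field K] [NumberField K] (S : Finset (HeightOneSpectrum (𝓞 K)))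

/-! ## §1. The record `TateDualityHypothesesAt p (classBarSD K S) (invS S)` -/

/-- **THE HYPOTHESES OF TATE'S DUALITY THEOREM AT `p` HOLD FOR `(G_S, C̄_S, inv_S)` WHEN `S ⊇ S_p`**: all ten fields of
bsd-line-x1-p1-w7's `DiscreteRep.TateDualityHypothesesAt p (classBarSD K S) (invS S)` — `p` prime; `ℚ/ℤ` injective
(`Module.Baer.of_divisible`); at every open normal `U ≤ G_S`: `inv_S ∘ cores_U` injective with the `p`-power torsion of `ℚ/ℤ`
in its range, `Ext¹_U(ℤ, Res C̄_S) = 0`, `Ext²_U(ℤ, Res C̄_S)` `p`-divisible (bsd-line-x1-p1-w5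
`tateDualityHypothesesAt_classBarSD_fields`), `Ext¹_U(ℤ, ℤ) = 0` (the constructor), `Extʳ_U(ℤ, Res C̄_S)` for `r ≥ 3` and
`Extʳ(N, C̄_S)` for torsion-free lattices `N`, `r ≥ 3`, killed by integers prime to `p` (bsd-line-x1-p1-w4
`ext_triv_coprime_classBarSD`, `hN_classBarSD`), and Milne's (b) `α¹(U, ℤ/p^a)` bijective (this seat's
`adjointBijective_one_zmod_pow_classBarSD`) — through the constructor `tateDualityHypothesesAt_of_coprime`.
[cite: Harari2020, §16.4 Remark 16.24, §17.1 Theorem 17.2, Theorem 17.18][cite: MilneADT2006, I Theorem 1.8, Lemma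
    1.9] -/
theorem tateDualityHypothesesAt_classBarSD {p : ℕ} [hp : Fact p.Prime]
    (hSp : ∀ v : HeightOneSpectrum (𝓞 K), ((p : ℕ) : 𝓞 K) ∈ v.asIdeal → v ∈ (↑S : Set (HeightOneSpectrum (𝓞 K)))) :
    haveI := totallyDisconnectedSpace_GS S
    DiscreteRep.TateDualityHypothesesAt p (classBarSD K S) (invS S) := by
  haveI := totallyDisconnectedSpace_GS S
  obtain ⟨h1, h2, h3, h4⟩ := tateDualityHypothesesAt_classBarSD_fields S hSp
  exact DiscreteRep.tateDualityHypothesesAt_of_coprime hp.out (Module.Baer.of_divisible _) h1 h2 h3 h4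
    (fun U r hr x => ext_triv_coprime_classBarSD S p hSp U r hr x)
    (adjointBijective_one_zmod_pow_classBarSD S hp.out.pos)
    (fun N hfin htf r hr x => hN_classBarSD p hSp N hfin htf r hr x)

/-! ## §2. Tate duality for the `S`-idèle class formation -/

/-- **Tate duality for `(G_S, C̄_S, inv_S)` at `p`** (`S ⊇ S_p`): for every finite `M ∈ C_{G_S}` killed by `p^k`, the
Yoneda duality maps `α²(G_S, M) : Ext²_{C_{G_S}}(M, C̄_S) → Hom(Hom(ℤ, M), ℚ/ℤ)` and
`α¹(G_S, M) : Ext¹_{C_{G_S}}(M, C̄_S) → Hom(Ext¹_{C_{G_S}}(ℤ, M), ℚ/ℤ)` are bijective and `Ext³_{C_{G_S}}(M, C̄_S) = 0`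
(bsd-line-x1-p1-w7's engine `tateDuality_finite_primary` on §1).
[cite: Harari2020, §16.3 Theorem 16.21, §16.4, Theorem 17.18][cite: MilneADT2006, I Theorem 1.8] -/
theorem tateDuality_classBarSD_of_pow_nsmul {p : ℕ} [Fact p.Prime]
    (hSp : ∀ v : HeightOneSpectrum (𝓞 K), ((p : ℕ) : 𝓞 K) ∈ v.asIdeal → v ∈ (↑S : Set (HeightOneSpectrum (𝓞 K))))
    (M : DiscreteRepCat ℤ (GaloisGroupUnramifiedOutside K (↑S : Set (HeightOneSpectrum (𝓞 K))))) [Finite M.obj.V]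
        (k : ℕ) (hM : ∀ v : M.obj.V, p ^ k • v = 0) :
    AdjointBijective (invS S) M (show 0 + 2 = 2 from rfl) ∧ AdjointBijective (invS S) M (show 1 + 1 = 2 from rfl) ∧
      ∀ x : Ext M (classBarSD K S) 3, x = 0 := by
  haveI := totallyDisconnectedSpace_GS S
  exact tateDuality_finite_primary (tateDualityHypothesesAt_classBarSD S hSp) M k hM

/-- **TATE DUALITY FOR THE `S`-IDÈLE CLASS FORMATION** (Tate 1962 / Milne ADT I Thm. 1.8 / Harari Thm. 17.18 for the
`P`-class formation `(G_S, C̄_S)`): for every number field `K`, every finite set `S` of finite places and every finite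
discrete `G_S`-module `M` such that `S` contains the places above every prime `ℓ` dividing `#M`, the maps
`αʳ(G_S, M) : Extʳ_{C_{G_S}}(M, C̄_S) → Hom(Ext²⁻ʳ_{C_{G_S}}(ℤ, M), ℚ/ℤ)` are bijective for `r = 2, 1` and
`Ext³_{C_{G_S}}(M, C̄_S) = 0` (§1 at every `ℓ ∣ #M` + the LEAD's primary decomposition `tateDuality_finite_of_primary`).
[cite: Harari2020, Theorem 17.18, §16.3 Theorem 16.21, Remark 16.24][cite: MilneADT2006, I Theorem 1.8, Theorem 4.10
    (a)]
[cite: Tate1963DualityICM, Theorem 2.1] -/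
theorem tateDuality_classBarSD (M : DiscreteRepCat ℤ (GaloisGroupUnramifiedOutside K (↑S : Set (HeightOneSpectrum
    (𝓞 K))))) [Finite M.obj.V]
    (hM : ∀ ℓ : ℕ, ℓ.Prime → ℓ ∣ Nat.card M.obj.V →
      ∀ v : HeightOneSpectrum (𝓞 K), ((ℓ : ℕ) : 𝓞 K) ∈ v.asIdeal → v ∈ (↑S : Set (HeightOneSpectrum (𝓞 K)))) :
    AdjointBijective (invS S) M (show 0 + 2 = 2 from rfl) ∧ AdjointBijective (invS S) M (show 1 + 1 = 2 from rfl) ∧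
      ∀ x : Ext M (classBarSD K S) 3, x = 0 := by
  haveI := totallyDisconnectedSpace_GS S
  exact tateDuality_finite_of_primary (classBarSD K S) (invS S) M fun ℓ hℓ hℓM =>
    haveI : Fact ℓ.Prime := ⟨hℓ⟩
    tateDualityHypothesesAt_classBarSD S (hM ℓ hℓ hℓM)

/-- **`α¹(G_S, M) : Ext¹_{C_{G_S}}(M, C̄_S) → Hom(Ext¹_{C_{G_S}}(ℤ, M), ℚ/ℤ)` is injective** for every finite `M ∈ C_{G_S}`
with `supp #M ⊆ S` — the `r = 1` input of Milne I 4.10 (b) / Harari 17.18 for `G_S` (`Ker γ¹ ⊆ Im β¹` on the presentation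
road). [cite: Harari2020, Theorem 17.18][cite: MilneADT2006, I Theorem 1.8 (b), Theorem 4.10 (proof)] -/
theorem adjointMap_one_injective_classBarSD (M : DiscreteRepCat ℤ (GaloisGroupUnramifiedOutside K (↑S : Set
    (HeightOneSpectrum (𝓞 K))))) [Finite M.obj.V]
    (hM : ∀ ℓ : ℕ, ℓ.Prime → ℓ ∣ Nat.card M.obj.V →
      ∀ v : HeightOneSpectrum (𝓞 K), ((ℓ : ℕ) : 𝓞 K) ∈ v.asIdeal → v ∈ (↑S : Set (HeightOneSpectrum (𝓞 K)))) :
    Function.Injective (adjointMap (invS S) M (show 1 + 1 = 2 from rfl)) :=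
  (tateDuality_classBarSD S M hM).2.1.1

/-! ## §3. The admissibility of the Poitou–Tate fact: `(#M : 𝓞 K) ∈ v ⇒ v ∈ S` -/

omit [NumberField K] in
/-- Support bookkeeping: if `(#M : 𝓞 K) ∈ v.asIdeal` forces `v ∈ S`, then so does `(ℓ : 𝓞 K) ∈ v.asIdeal` for every prime
`ℓ ∣ #M` (`#M = ℓ · c` lies in the ideal with `ℓ`; private plumbing). [folklore] -/
private theorem forall_prime_dvd_mem_of_natCard_mem {N : ℕ}
    (hM : ∀ v : HeightOneSpectrum (𝓞 K), ((N : ℕ) : 𝓞 K) ∈ v.asIdeal → v ∈ (↑S : Set (HeightOneSpectrum (𝓞 K)))) :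
    ∀ ℓ : ℕ, ℓ.Prime → ℓ ∣ N →
      ∀ v : HeightOneSpectrum (𝓞 K), ((ℓ : ℕ) : 𝓞 K) ∈ v.asIdeal → v ∈ (↑S : Set (HeightOneSpectrum (𝓞 K))) := by
  intro ℓ _ hℓ v hv
  obtain ⟨c, hc⟩ := hℓ
  refine hM v ?_
  rw [hc, Nat.cast_mul]
  exact v.asIdeal.mul_mem_right _ hv

/-- **Tate duality for `(G_S, C̄_S, inv_S)` under the admissibility hypothesis of the Poitou–Tate fact**
(`∀ v, (#M : 𝓞 K) ∈ v.asIdeal → v ∈ S`, the binder shape of `GaloisCohomology.poitouTate_shaRestricted_tateDual_natural_at`).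
[cite: Harari2020, Theorem 17.18][cite: MilneADT2006, I Theorem 1.8, Theorem 4.10 (a)] -/
theorem tateDuality_classBarSD_of_natCard_mem (M : DiscreteRepCat ℤ (GaloisGroupUnramifiedOutside K (↑S : Set
    (HeightOneSpectrum (𝓞 K))))) [Finite M.obj.V]
    (hM : ∀ v : HeightOneSpectrum (𝓞 K), ((Nat.card M.obj.V : ℕ) : 𝓞 K) ∈ v.asIdeal →
      v ∈ (↑S : Set (HeightOneSpectrum (𝓞 K)))) :
    AdjointBijective (invS S) M (show 0 + 2 = 2 from rfl) ∧ AdjointBijective (invS S) M (show 1 + 1 = 2 from rfl) ∧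
      ∀ x : Ext M (classBarSD K S) 3, x = 0 :=
  tateDuality_classBarSD S M (forall_prime_dvd_mem_of_natCard_mem S hM)

/-- **`α¹(G_S, M)` is BIJECTIVE** for every finite `M ∈ C_{G_S}` with `(#M : 𝓞 K) ∈ v ⇒ v ∈ S` — the hypothesis `hα` of
bsd-line-x1-p1-w2's D5c kit `ShaExtRoadKit.natural_at_of_kit` (there at `M := ⟨(M^D(n))^{N_S}⟩`), as a plain
`Function.Bijective` statement on `ExtDuality.adjointMap (invS S) M (1 + 1 = 2)`.
[cite: Harari2020, Theorem 17.18][cite: MilneADT2006, I Theorem 1.8 (b)] -/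
theorem adjointMap_one_bijective_classBarSD (M : DiscreteRepCat ℤ (GaloisGroupUnramifiedOutside K (↑S : Set
    (HeightOneSpectrum (𝓞 K))))) [Finite M.obj.V]
    (hM : ∀ v : HeightOneSpectrum (𝓞 K), ((Nat.card M.obj.V : ℕ) : 𝓞 K) ∈ v.asIdeal →
      v ∈ (↑S : Set (HeightOneSpectrum (𝓞 K)))) :
    Function.Bijective (adjointMap (invS S) M (show 1 + 1 = 2 from rfl)) :=
  (tateDuality_classBarSD_of_natCard_mem S M hM).2.1

/-- **`α²(G_S, M)` is BIJECTIVE** (`Ext²_{C_{G_S}}(M, C̄_S) ≅ Hom(Hom_{G_S}(ℤ, M), ℚ/ℤ)`) for the same `M`.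
[cite: Harari2020, Theorem 17.18][cite: MilneADT2006, I Theorem 1.8 (a)] -/
theorem adjointMap_two_bijective_classBarSD (M : DiscreteRepCat ℤ (GaloisGroupUnramifiedOutside K (↑S : Set
    (HeightOneSpectrum (𝓞 K))))) [Finite M.obj.V]
    (hM : ∀ v : HeightOneSpectrum (𝓞 K), ((Nat.card M.obj.V : ℕ) : 𝓞 K) ∈ v.asIdeal →
      v ∈ (↑S : Set (HeightOneSpectrum (𝓞 K)))) :
    Function.Bijective (adjointMap (invS S) M (show 0 + 2 = 2 from rfl)) :=
  (tateDuality_classBarSD_of_natCard_mem S M hM).1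

/-- **`Ext³_{C_{G_S}}(M, C̄_S) = 0`** for the same `M`. [cite: Harari2020, Theorem 17.18][cite: MilneADT2006, I Theorem 1.8] -/
theorem ext_three_eq_zero_classBarSD (M : DiscreteRepCat ℤ (GaloisGroupUnramifiedOutside K (↑S : Set
    (HeightOneSpectrum (𝓞 K))))) [Finite M.obj.V]
    (hM : ∀ v : HeightOneSpectrum (𝓞 K), ((Nat.card M.obj.V : ℕ) : 𝓞 K) ∈ v.asIdeal →
      v ∈ (↑S : Set (HeightOneSpectrum (𝓞 K)))) (x : Ext M (classBarSD K S) 3) : x = 0 :=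
  (tateDuality_classBarSD_of_natCard_mem S M hM).2.2 x

end IdeleClassBar

end Literature.NumberTheory.GaloisRepresentations

end
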